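import Summits.BirchSwinnertonDyer.BirchSwinnertonDyer.Theorems.ManinLocalTwoThreeManinOddAtFourOddUntwist
import Summits.BirchSwinnertonDyer.BirchSwinnertonDyer.Theorems.ManinLocalTwoThreeTwistCoveredReductions
import HarnessLib

/-!
# Route `ManinLocalTwoThree`: the ODD-UNTWISTING REDUCTION of the C3 core `stub_twistMinimalAtThree`
# (crux `ManinPrimeToThreeAtNine`, stmt-BirchSwinnertonDyer-22968), and both cruxes REDUCED to their
# «no semistable untwist» cores

Sequel of `ManinLocalTwoThreeManinOddAtFourOddUntwist.lean` (the prime-generic transport lemma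
`maninLocalTwoThree_not_dvd_maninConstant_of_oddUntwist`: `p ∤ c` descends along an odd semistable
untwist `W ∼ W' ⊗ ℚ(√q*)`, `q² ∣ N`, `q² ∤ N(W')`) and of `ManinLocalTwoThreeTwistCoveredReductions.lean`
(each crux ⟸ its twist-minimal stub alone).
* `maninLocalTwoThree_twistMinimalAtThree_of_oddUntwistMinimal` — the birth stub
  `stub_twistMinimalAtThree` of C3 (verbatim as the conclusion) FOLLOWS from its restriction to the
  classes admitting no semistable untwist at any odd prime `q ≠ 3` with `q² ∣ N` (strong induction on
  the level, `p = 3` in the transport lemma; `f₃` and ternary twist-minimality are inherited by the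
  partner class since `χ_{q*}` is unramified at `3`).
* `maninLocalTwoThree_maninOddAtFour_of_oddUntwistMinimal`,
  `maninLocalTwoThree_maninPrimeToThreeAtNine_of_oddUntwistMinimal` — **C2 resp. C3 ⟸ ONE hypothesis**:
  Manin's conjecture at `2` resp. `3` for the optimal curves with `4 ∣ N` resp. `9 ∣ N` whose class is
  twist-minimal at the prime (no `χ₋₄/χ_{±8}`- resp. `χ₋₃`-untwist to a class semistable there) AND has
  no odd semistable untwist `χ_{q*}` (`q ≠ p`, `q² ∣ N`): the «globally twist-minimal» cores. These are
  OPEN (no printed theorem); nothing here proves BSD or Manin's conjecture. Seat bsd-line-manin23-p2.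

References: [Stevens1989] Lemmas (5.2), (5.4); [Cesnavicius2018] Thm. 1.2; [SilvermanATAEC1994] IV.9.4.
-/

set_option autoImplicit false
set_option linter.dupNamespace false

noncomputable section

open scoped Classical NumberField

namespace Summit.BirchSwinnertonDyer.BirchSwinnertonDyer.Theorems

open WeierstrassCurve IsDedekindDomain IsDedekindDomain.HeightOneSpectrum Rat.HeightOneSpectrum
  Literature.NumberTheory.Automorphic
  Literature.NumberTheory.EllipticCurves Literature.NumberTheory.EllipticCurves.ModularForms

/-- **ODD-UNTWISTING REDUCTION of the C3 core.** The birth stub `stub_twistMinimalAtThree` of crux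
`ManinPrimeToThreeAtNine` (verbatim as the conclusion) follows from its restriction to the classes
that admit no semistable untwist at an odd prime `q ≠ 3` with `q² ∣ N` (`W ∼ W' ⊗ ℚ(√q*)`, `W'`
globally minimal, `q² ∤ N(W')`). Strong induction on the level with the transport lemma at `p = 3`;
an untwist at `q = 3` itself is excluded by ternary twist-minimality.
[cite: Stevens1989, Lemmas (5.2), (5.4)] [cite: SilvermanATAEC1994, IV.9.4] -/
theorem maninLocalTwoThree_twistMinimalAtThree_of_oddUntwistMinimal
    (H : Literature.NumberTheory.EllipticCurves.ModularForms.mazur_not_dvd_maninConstant_of_odd →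
      Literature.NumberTheory.EllipticCurves.ModularForms.abbesUllmo_not_dvd_maninConstant_of_not_dvd_level →
      Literature.NumberTheory.EllipticCurves.ModularForms.cesnavicius_not_two_dvd_maninConstant_of_two_dvd_level →
      Literature.NumberTheory.EllipticCurves.ModularForms.exists_isNewformOf →
      ∀ (W : WeierstrassCurve ℚ) [W.IsElliptic] [W.IsGloballyMinimal] {N : ℕ} [NeZero N]
        (D : ModularParametrizationData W N),
        (∀ z ∈ D.L.lattice, ∃ w ∈ periodLattice D.f, z = D.c * w) → 3 ^ 2 ∣ N →
        ¬ (∃ (W' : WeierstrassCurve ℚ) (d : ℤ), W'.IsElliptic ∧ W'.IsGloballyMinimal ∧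
          (d = -3) ∧ IsIsogenous W (W'.quadraticTwist (d : ℚ)) ∧
          ¬ 3 ^ 2 ∣ W'.conductorNorm ℤ) →
        ¬ (∃ (W' : WeierstrassCurve ℚ) (q : ℕ), W'.IsElliptic ∧ W'.IsGloballyMinimal ∧
          q.Prime ∧ q ≠ 2 ∧ q ≠ 3 ∧ q ^ 2 ∣ N ∧
          IsIsogenous W (W'.quadraticTwist (((-1 : ℤ) ^ (q / 2) * q : ℤ) : ℚ)) ∧
          ¬ q ^ 2 ∣ W'.conductorNorm ℤ) →
        ¬ (3 : ℤ) ∣ D.maninConstant) :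
    Literature.NumberTheory.EllipticCurves.ModularForms.mazur_not_dvd_maninConstant_of_odd →
    Literature.NumberTheory.EllipticCurves.ModularForms.abbesUllmo_not_dvd_maninConstant_of_not_dvd_level →
    Literature.NumberTheory.EllipticCurves.ModularForms.cesnavicius_not_two_dvd_maninConstant_of_two_dvd_level →
    Literature.NumberTheory.EllipticCurves.ModularForms.exists_isNewformOf →
    ∀ (W : WeierstrassCurve ℚ) [W.IsElliptic] [W.IsGloballyMinimal] {N : ℕ} [NeZero N]
      (D : ModularParametrizationData W N),
      (∀ z ∈ D.L.lattice, ∃ w ∈ periodLattice D.f, z = D.c * w) → 3 ^ 2 ∣ N →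
      ¬ (∃ (W' : WeierstrassCurve ℚ) (d : ℤ), W'.IsElliptic ∧ W'.IsGloballyMinimal ∧
        (d = -3) ∧ IsIsogenous W (W'.quadraticTwist (d : ℚ)) ∧
        ¬ 3 ^ 2 ∣ W'.conductorNorm ℤ) →
      ¬ (3 : ℤ) ∣ D.maninConstant := by
  intro hM hAU hC2 hnf
  suffices key : ∀ (n : ℕ) (W : WeierstrassCurve ℚ) [W.IsElliptic] [W.IsGloballyMinimal] (N : ℕ)
      [NeZero N] (D : ModularParametrizationData W N), N < n →
      (∀ z ∈ D.L.lattice, ∃ w ∈ periodLattice D.f, z = D.c * w) → 3 ^ 2 ∣ N →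
      ¬ (∃ (W' : WeierstrassCurve ℚ) (d : ℤ), W'.IsElliptic ∧ W'.IsGloballyMinimal ∧
        (d = -3) ∧ IsIsogenous W (W'.quadraticTwist (d : ℚ)) ∧
        ¬ 3 ^ 2 ∣ W'.conductorNorm ℤ) →
      ¬ (3 : ℤ) ∣ D.maninConstant by
    intro W _ _ N _ D hopt h9 hmin
    exact key (N + 1) W N D (Nat.lt_succ_self N) hopt h9 hmin
  intro n
  induction n with
  | zero => intro W _ _ N _ D hN; exact absurd hN (Nat.not_lt_zero N)
  | succ n ih =>
    intro W _ _ N _ D hNn hopt h9 hmin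
    by_cases hodd : ∃ (W' : WeierstrassCurve ℚ) (q : ℕ), W'.IsElliptic ∧ W'.IsGloballyMinimal ∧
        q.Prime ∧ q ≠ 2 ∧ q ≠ 3 ∧ q ^ 2 ∣ N ∧
        IsIsogenous W (W'.quadraticTwist (((-1 : ℤ) ^ (q / 2) * q : ℤ) : ℚ)) ∧
        ¬ q ^ 2 ∣ W'.conductorNorm ℤ
    · obtain ⟨W', q, hE', hM', hqp, hq2, hq3, hqN, htw, hqN'⟩ := hodd
      haveI := hE'
      haveI := hM'
      haveI : Fact q.Prime := ⟨hqp⟩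
      refine maninLocalTwoThree_not_dvd_maninConstant_of_oddUntwist hnf hq2 D hopt hqN htw hqN' ?_
      intro W₁ _ _ N₁ _ D₁ hiso₁ hopt₁
      have hd0 : ((((-1 : ℤ) ^ (q / 2) * q : ℤ)) : ℚ) ≠ 0 := by
        push_cast
        exact mul_ne_zero (pow_ne_zero _ (by norm_num)) (by exact_mod_cast hqp.ne_zero)
      haveI : (W'.quadraticTwist (((-1 : ℤ) ^ (q / 2) * q : ℤ) : ℚ)).IsElliptic :=
        W'.isElliptic_quadraticTwist hd0
      have hN : N = W.conductorNorm ℤ :=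
        IsNewformOf.level_eq_conductorNorm_of_exists_isNewformOf hnf D.isNewformOf
      have hN₁ : N₁ = W'.conductorNorm ℤ := level_eq_conductorNorm_of_isIsogenous hnf D₁ hiso₁
      have hqNW : q ^ 2 ∣ W.conductorNorm ℤ := hN ▸ hqN
      have hadd : ¬ W.HasGoodReductionAtPrime q ∧ ¬ W.HasMultiplicativeReductionAtPrime q :=
        Summit.BirchSwinnertonDyer.Rank1Residual.ManinAdditive.not_good_and_not_mult_of_sq_dvd_conductorNorm
          W hqNW
      have hN'N : W'.conductorNorm ℤ ∣ W.conductorNorm ℤ :=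
        maninLocalTwoThree_conductorNorm_dvd_of_isIsogenous_twist_pStar hnf hq2 htw hqN' hadd
      have hv3 : natGenerator ((primesEquiv (R := ℤ)).symm ⟨3, Nat.prime_three⟩) ≠ q := by
        rw [natGenerator_primesEquiv_symm Nat.prime_three]; exact fun h ↦ hq3 h.symm
      have hlt : N₁ < N := by
        rw [hN₁, hN]
        refine lt_of_le_of_ne (Nat.le_of_dvd (conductorNorm_pos_holds W) hN'N) fun h ↦ hqN' ?_
        rw [h]; exact hqNW
      have h9₁ : 3 ^ 2 ∣ N₁ := by
        have h3W : 2 ≤ (W.conductorNorm ℤ).factorization 3 :=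
          (Nat.prime_three.pow_dvd_iff_le_factorization (conductorNorm_pos_holds W).ne').mp (hN ▸ h9)
        rw [hN₁]
        refine (Nat.prime_three.pow_dvd_iff_le_factorization (conductorNorm_pos_holds W').ne').mpr ?_
        have hf3 := maninLocalTwoThree_conductorExponent_eq_of_isIsogenous_twist_pStar hnf hq2 htw
          ((primesEquiv (R := ℤ)).symm ⟨3, Nat.prime_three⟩) hv3
        have e1 := factorization_conductorNorm_primesEquiv_symm W ⟨3, Nat.prime_three⟩
        have e2 := factorization_conductorNorm_primesEquiv_symm W' ⟨3, Nat.prime_three⟩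
        simp only at e1 e2
        rw [e2, ← hf3, ← e1]
        exact h3W
      have hmin₁ : ¬ (∃ (V : WeierstrassCurve ℚ) (d : ℤ), V.IsElliptic ∧ V.IsGloballyMinimal ∧
          (d = -3) ∧ IsIsogenous W₁ (V.quadraticTwist (d : ℚ)) ∧ ¬ 3 ^ 2 ∣ V.conductorNorm ℤ) := by
        rintro ⟨V, d, hVe, hVm, hd, hisoV, h9V⟩
        haveI := hVe
        haveI := hVm
        subst hd
        have hdq : ((-3 : ℤ) : ℚ) ≠ 0 := by norm_num
        haveI : (V.quadraticTwist ((-3 : ℤ) : ℚ)).IsElliptic := V.isElliptic_quadraticTwist hdq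
        haveI : (V.quadraticTwist (((-1 : ℤ) ^ (q / 2) * q : ℤ) : ℚ)).IsElliptic :=
          V.isElliptic_quadraticTwist hd0
        obtain ⟨C, hCmin⟩ :=
          hasGlobalMinimalModel_rat_holds (V.quadraticTwist (((-1 : ℤ) ^ (q / 2) * q : ℤ) : ℚ))
        haveI := hCmin
        apply hmin
        refine ⟨C • V.quadraticTwist (((-1 : ℤ) ^ (q / 2) * q : ℤ) : ℚ), -3, inferInstance, hCmin,
          rfl, ?_, ?_⟩
        · have h1 : IsIsogenous W' (V.quadraticTwist ((-3 : ℤ) : ℚ)) := hiso₁.trans' hisoV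
          have h2 : IsIsogenous (W'.quadraticTwist (((-1 : ℤ) ^ (q / 2) * q : ℤ) : ℚ))
              ((V.quadraticTwist ((-3 : ℤ) : ℚ)).quadraticTwist (((-1 : ℤ) ^ (q / 2) * q : ℤ) : ℚ)) :=
            h1.quadraticTwist hd0
          rw [quadraticTwist_quadraticTwist, mul_comm ((-3 : ℤ) : ℚ) ((((-1 : ℤ) ^ (q / 2) * q : ℤ)) : ℚ),
            ← quadraticTwist_quadraticTwist] at h2
          have h3 : IsIsogenous
              ((V.quadraticTwist (((-1 : ℤ) ^ (q / 2) * q : ℤ) : ℚ)).quadraticTwist ((-3 : ℤ) : ℚ))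
              ((C • V.quadraticTwist (((-1 : ℤ) ^ (q / 2) * q : ℤ) : ℚ)).quadraticTwist ((-3 : ℤ) : ℚ)) := by
            rw [quadraticTwist_smul]; exact isIsogenous_smul _ _
          exact (htw.trans' h2).trans' h3
        · rw [conductorNorm_smul_rat]
          intro h9V₂
          apply h9V
          have hC1 : (1 : VariableChange ℚ) • V.quadraticTwist ((-1 : ℚ) ^ (q / 2) * q) =
              V.quadraticTwist (((-1 : ℤ) ^ (q / 2) * q : ℤ) : ℚ) := by
            rw [one_smul]; push_cast; rfl
          have hf := Summit.BirchSwinnertonDyer.Rank1Residual.Additive.conductorExponent_eq_of_twist_pStar_of_ne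
            q hq2 V _ 1 hC1 ((primesEquiv (R := ℤ)).symm ⟨3, Nat.prime_three⟩) hv3
          have e1 := factorization_conductorNorm_primesEquiv_symm V ⟨3, Nat.prime_three⟩
          have e2 := factorization_conductorNorm_primesEquiv_symm
            (V.quadraticTwist (((-1 : ℤ) ^ (q / 2) * q : ℤ) : ℚ)) ⟨3, Nat.prime_three⟩
          simp only at e1 e2
          refine (Nat.prime_three.pow_dvd_iff_le_factorization (conductorNorm_pos_holds V).ne').mpr ?_
          rw [e1, ← hf, ← e2]
          exact (Nat.prime_three.pow_dvd_iff_le_factorization (conductorNorm_pos_holds _).ne').mp h9V₂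
      exact ih W₁ N₁ D₁ (by omega) hopt₁ h9₁ hmin₁
    · exact H hM hAU hC2 hnf W D hopt h9 hmin hodd

/-- **Crux C2 `ManinOddAtFour` ⟸ its globally-twist-minimal core** (one hypothesis): Manin's conjecture
at `2`, modulo the printed facts, for the optimal curves with `4 ∣ N` whose class is dyadically
twist-minimal AND admits no odd semistable untwist. Composition of the landed reductions
`maninLocalTwoThree_maninOddAtFour_of_twistMinimalAtTwo` and
`maninLocalTwoThree_twistMinimalAtTwo_of_oddUntwistMinimal`. [cite: Stevens1989, Lemmas (5.2), (5.4)]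
[cite: Cesnavicius2018, Thm. 1.2] -/
theorem maninLocalTwoThree_maninOddAtFour_of_oddUntwistMinimal
    (H : Literature.NumberTheory.EllipticCurves.ModularForms.mazur_not_dvd_maninConstant_of_odd →
      Literature.NumberTheory.EllipticCurves.ModularForms.abbesUllmo_not_dvd_maninConstant_of_not_dvd_level →
      Literature.NumberTheory.EllipticCurves.ModularForms.cesnavicius_not_two_dvd_maninConstant_of_two_dvd_level →
      Literature.NumberTheory.EllipticCurves.ModularForms.exists_isNewformOf →
      ∀ (W : WeierstrassCurve ℚ) [W.IsElliptic] [W.IsGloballyMinimal] {N : ℕ} [NeZero N]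
        (D : ModularParametrizationData W N),
        (∀ z ∈ D.L.lattice, ∃ w ∈ periodLattice D.f, z = D.c * w) → 2 ^ 2 ∣ N →
        ¬ (∃ (W' : WeierstrassCurve ℚ) (d : ℤ), W'.IsElliptic ∧ W'.IsGloballyMinimal ∧
          (d = -1 ∨ d = 2 ∨ d = -2) ∧ IsIsogenous W (W'.quadraticTwist (d : ℚ)) ∧
          ¬ 2 ^ 2 ∣ W'.conductorNorm ℤ) →
        ¬ (∃ (W' : WeierstrassCurve ℚ) (q : ℕ), W'.IsElliptic ∧ W'.IsGloballyMinimal ∧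
          q.Prime ∧ q ≠ 2 ∧ q ^ 2 ∣ N ∧
          IsIsogenous W (W'.quadraticTwist (((-1 : ℤ) ^ (q / 2) * q : ℤ) : ℚ)) ∧
          ¬ q ^ 2 ∣ W'.conductorNorm ℤ) →
        ¬ (2 : ℤ) ∣ D.maninConstant) :
    Summit.BirchSwinnertonDyer.BirchSwinnertonDyer.Theses.ManinLocalTwoThree.ManinOddAtFour :=
  maninLocalTwoThree_maninOddAtFour_of_twistMinimalAtTwo
    (maninLocalTwoThree_twistMinimalAtTwo_of_oddUntwistMinimal H)

/-- **Crux C3 `ManinPrimeToThreeAtNine` ⟸ its globally-twist-minimal core** (one hypothesis): Manin's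
conjecture at `3`, modulo the printed facts, for the optimal curves with `9 ∣ N` whose class is
ternary-twist-minimal AND admits no semistable untwist at an odd `q ≠ 3`. Composition of
`maninLocalTwoThree_maninPrimeToThreeAtNine_of_twistMinimalAtThree` and
`maninLocalTwoThree_twistMinimalAtThree_of_oddUntwistMinimal`. [cite: Stevens1989, Lemmas (5.2), (5.4)]
[cite: Cesnavicius2018, Thm. 1.2] -/
theorem maninLocalTwoThree_maninPrimeToThreeAtNine_of_oddUntwistMinimal
    (H : Literature.NumberTheory.EllipticCurves.ModularForms.mazur_not_dvd_maninConstant_of_odd →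
      Literature.NumberTheory.EllipticCurves.ModularForms.abbesUllmo_not_dvd_maninConstant_of_not_dvd_level →
      Literature.NumberTheory.EllipticCurves.ModularForms.cesnavicius_not_two_dvd_maninConstant_of_two_dvd_level →
      Literature.NumberTheory.EllipticCurves.ModularForms.exists_isNewformOf →
      ∀ (W : WeierstrassCurve ℚ) [W.IsElliptic] [W.IsGloballyMinimal] {N : ℕ} [NeZero N]
        (D : ModularParametrizationData W N),
        (∀ z ∈ D.L.lattice, ∃ w ∈ periodLattice D.f, z = D.c * w) → 3 ^ 2 ∣ N →
        ¬ (∃ (W' : WeierstrassCurve ℚ) (d : ℤ), W'.IsElliptic ∧ W'.IsGloballyMinimal ∧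
          (d = -3) ∧ IsIsogenous W (W'.quadraticTwist (d : ℚ)) ∧
          ¬ 3 ^ 2 ∣ W'.conductorNorm ℤ) →
        ¬ (∃ (W' : WeierstrassCurve ℚ) (q : ℕ), W'.IsElliptic ∧ W'.IsGloballyMinimal ∧
          q.Prime ∧ q ≠ 2 ∧ q ≠ 3 ∧ q ^ 2 ∣ N ∧
          IsIsogenous W (W'.quadraticTwist (((-1 : ℤ) ^ (q / 2) * q : ℤ) : ℚ)) ∧
          ¬ q ^ 2 ∣ W'.conductorNorm ℤ) →
        ¬ (3 : ℤ) ∣ D.maninConstant) :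
    Summit.BirchSwinnertonDyer.BirchSwinnertonDyer.Theses.ManinLocalTwoThree.ManinPrimeToThreeAtNine :=
  maninLocalTwoThree_maninPrimeToThreeAtNine_of_twistMinimalAtThree
    (maninLocalTwoThree_twistMinimalAtThree_of_oddUntwistMinimal H)

end Summit.BirchSwinnertonDyer.BirchSwinnertonDyer.Theorems

end
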